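import Summits.BirchSwinnertonDyer.BirchSwinnertonDyer.Theorems.ByReductionTypeAtTwoAdditiveDescentKClosed
import Literature.NumberTheory.EllipticCurves.PAdicLFunctionMinusMultTwistConstantTermAtTwoProofs
import Literature.NumberTheory.EllipticCurves.PAdicLFunctionMinusMultConstantTermAtTwoProofs
import Literature.NumberTheory.EllipticCurves.PAdicLFunctionMinusMultGammaTwistUnitTwistProofs
import Literature.NumberTheory.EllipticCurves.QuadraticTwistFundamentalEulerProductProofs
import Literature.NumberTheory.EllipticCurves.PAdicLFunctionMinusIntegralityAtTwoProofs
import Literature.NumberTheory.EllipticCurves.CuspFormLFunctionLevelConductorProofs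
import Literature.NumberTheory.EllipticCurves.PAdicBSDSplitMultiplicativeProofs
import Literature.NumberTheory.EllipticCurves.LFunctionSmulProofs
import Literature.NumberTheory.LFunctions.DirichletLValueBernoulli
import HarnessLib

/-!
# Route ByReductionTypeAtTwo, crux C4″ `AdditivePotMultOverKAtTwo` (stmt-BirchSwinnertonDyer-22618; parent
# `AdditiveRankZeroAtTwo` 19098) — R18, part 1a: the binder «an integral multiple `L̃ = 2^m·L⁻ ≠ 0` of the odd branch»
# of the (−1)-block print-level doors is NOT data — `L̃` EXISTS (`m = 0`) and `L̃ ≠ 0 ⟸ L(W, 1) ≠ 0`, the crux's own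
# hypothesis `r_an(W) = 0` (theorems only)

Cell `bsd-2adic`, seat `bsd-2adic-k4-w3` GEN 6. GEN 5's `katoDivisibility_negOneSplitTwist_two_of_print_of_input`
(`…PrintExactAnyImagePrintDoors`, p708200) displays, besides four PRINT facts and the ONE typed input, the DATA
`(Lt : Λ) (m : ℕ) (hLt : ι Lt = 2^m · L⁻) (hLt0 : Lt ≠ 0)` — `L⁻ = L⁻₂(f_{W′}, 1, ω, T)` the odd branch of the one-term
Mazur–Tate–Teitelbaum measure of the split multiplicative `W′ ≅ W^{(−1)}` — ASSUMED non-zero. This file discharges it: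

* §1 `LFunction_eq_jacobiSym_mul_of_twist` — **`aₙ(W) = χ_{4m}(n)·aₙ(W′)` for all `n`** when `W ≅ W′^{(m)}`,
  `m ≡ 2, 3 (mod 4)` square-free, and `W′` is SEMISTABLE (good OR multiplicative) at the primes of `4m`: the tree's
  fundamental-discriminant Euler product `LFunction_quadraticTwist_prime_pow_of_fundamental` at `d = 4m` (the twist is
  additive at a ramified prime of semistable reduction, so both sides vanish there), glued over prime powers by
  multiplicativity (`isMultiplicative_LFunction`). The multiplicative-base twin of the coefficient step of addL2 GEN 7's
  `AddDescentK.entireLFunction_one_mul_two_eq_of_twist_neg_four` (stated there for `W′` GOOD at `2`).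
* §2 `entireLFunction_one_mul_two_eq_of_twist_neg_one_of_isSemistableAt` — **`2·L(W, 1) = ([1/4]⁻_f − [3/4]⁻_f)·Ω⁻_f`**
  (Birch's formula for `χ₋₄`, tree `ratMinusTwistedSymbolSum_mul_minusPeriod_mul_I`, `τ(χ₋₄) = 2i`);
  `padicLFunctionMinusBranchMult_ne_zero_of_entireLFunction_ne_zero` — **`L⁻₂(f_{W′}, 1, ω, T) ≠ 0 ⟸ L(W, 1) ≠ 0`** (its
  constant term is `[1/4]⁻ − [3/4]⁻`: `constantCoeff_padicLFunctionMinusBranchMult_one_two_of_split`, p709613 — the `T = 0`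
  interpolation at `2 ∣ N`, MTT §I.13–I.14 with `ε(2) = 0`); `exists_iwasawa_lift_oddBranch{,_ne_zero}` — **`∃ L̃ ∈ Λ,
  ι L̃ = 2⁰·L⁻ ∧ L̃ ≠ 0`** (integrality: tree `exists_iwasawaToPowerSeries_eq_padicLFunctionMinusBranchMult_two`, MTT §I.12).

The (−2)-block twin is the sequel `…PrintExactAnyImageNonvanishingNegTwo`; both are consumed by `…PrintExactAnyImageFinalDoors`.

HONEST FRAMING (D-0036 / D-0054): theorems only — no definition, no named fact, no instance, no `sorry`;
route-independent; CONDITIONAL only on `hasEntireLFunction_rat` (PRINT: modularity ⟹ entire `L(W,s)`, where used);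
types-the-object-of (a displayed DATA binder of the Iwasawa-level word of the split-twist blocks of C4″ ↦ KERNEL + the
crux's own `r_an = 0`); closes none; nothing booked; BSD is not proved by any of this. PARTITION: X5@2 additive
potentially-multiplicative block, the (−1)-split-twist sub-blocks (128 + 41 classes) × `p = 2`.

References: [MazurTateTeitelbaum1986Invent] §I.8 (8.6), §I.10 (10.1), §I.12–I.14; [SilvermanAEC2009] X.2 with
Exercise 10.16, VII.5.4, §C.16; [Cox2013] §1.C Lemma 1.14; memo `run/shared/lean/pub/bsd-2adic/k4w3/gen6/VERDICT-22618-k4w3-GEN6.md`.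
-/

set_option autoImplicit false
-- the summit's namespace `Summit.BirchSwinnertonDyer.BirchSwinnertonDyer` (Sub = Summit) trips `dupNamespace`
set_option linter.dupNamespace false

noncomputable section

open scoped Classical MatrixGroups ModularForm NumberField NumberTheorySymbols

open Field CongruenceSubgroup WeierstrassCurve IsDedekindDomain Rat.HeightOneSpectrum
  Literature.NumberTheory.EllipticCurves Literature.NumberTheory.EllipticCurves.ModularForms
  Literature.NumberTheory.EllipticCurves.IwasawaAlgebra Literature.NumberTheory.QuadraticFields
  Summit.BirchSwinnertonDyer.BirchSwinnertonDyer.Theorems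

namespace Summit.BirchSwinnertonDyer.BirchSwinnertonDyer.Theorems.AddKatoTwo

/-! ## §1 The Dirichlet coefficients of the twist `W ≅ W′ ⊗ χ_{4m}` of a curve semistable at the primes of `4m` -/

section Coefficients

variable (W W' : WeierstrassCurve ℚ) [W'.IsElliptic] {m : ℤ}
  (hm4 : m % 4 = 2 ∨ m % 4 = 3) (hsq : Squarefree m)
  (hWtw : ∃ C : VariableChange ℚ, C • W'.quadraticTwist (m : ℚ) = W)
  (hss : ∀ v : HeightOneSpectrum (𝓞 ℚ), ((primesEquiv v : ℕ) : ℤ) ∣ 4 * m → W'.IsSemistableAt v)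

include hm4 hWtw in
/-- `L(W, s)` and `L(W′^{(4m)}, s)` have the same Dirichlet coefficients (`W ≅ W′^{(m)} ≅ W′^{(4m)}`: twisting by `m` and
by `m·2²` give isomorphic curves; `LFunction_smul`). [cite: SilvermanAEC2009, X.5 Cor. 5.4 and §C.16] -/
theorem LFunction_eq_LFunction_quadraticTwist_four_mul :
    W.LFunction = (W'.quadraticTwist ((4 * m : ℤ) : ℚ)).LFunction := by
  obtain ⟨C₂, hC₂⟩ := hWtw
  have hm0 : (m : ℚ) ≠ 0 := by
    have : m ≠ 0 := by rintro rfl; norm_num at hm4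
    exact_mod_cast this
  obtain ⟨C₁, hC₁⟩ := W'.exists_variableChange_quadraticTwist_mul_sq (m : ℚ) (2 : ℚ) two_ne_zero
  haveI : (W'.quadraticTwist (m : ℚ)).IsElliptic := W'.isElliptic_quadraticTwist hm0
  have h4 : ((4 * m : ℤ) : ℚ) = (m : ℚ) * (2 : ℚ) ^ 2 := by push_cast; ring
  rw [h4, ← hC₁, LFunction_smul, ← hC₂, LFunction_smul]

include hm4 hsq hWtw hss in
/-- **`aₙ(W) = χ_{4m}(n)·aₙ(W′)` for every `n`** (`χ_{4m}(n) = (m/n)` for odd `n`, `0` for even `n`), for `W ≅ W′^{(m)}`,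
`m ≡ 2, 3 (mod 4)` square-free, `W′` SEMISTABLE at the primes of `4m`: on prime powers this is the tree's
`LFunction_quadraticTwist_prime_pow_of_fundamental` at the fundamental discriminant `d = 4m` (`(4m/p) = (m/p)` for odd `p`;
at a prime of `4m` the twist is additive — ramified prime of semistable reduction — and both sides vanish), and both sides
are multiplicative arithmetic functions (`isMultiplicative_LFunction`). [cite: SilvermanAEC2009, X.2 and Exercise 10.16, VII.5.4, §C.16] -/
theorem LFunction_eq_jacobiSym_mul_of_twist (n : ℕ) :
    W.LFunction n = (if Even n then 0 else J(m | n)) * W'.LFunction n := by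
  -- the twisting character as a multiplicative arithmetic function
  let ε : ArithmeticFunction ℤ := ⟨fun n ↦ if Even n then 0 else J(m | n), by simp⟩
  have hε : ∀ n : ℕ, ε n = if Even n then 0 else J(m | n) := fun _ ↦ rfl
  have hε1 : ε 1 = 1 := by rw [hε, if_neg (by decide), jacobiSym.one_right]
  have hεmul : ∀ a b : ℕ, ε (a * b) = ε a * ε b := by
    intro a b
    simp only [hε]
    by_cases ha : Even a
    · simp [ha]
    · by_cases hb : Even b
      · simp [hb]
      · have hab : ¬ Even (a * b) := by rw [Nat.even_mul, not_or]; exact ⟨ha, hb⟩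
        simp only [if_neg ha, if_neg hb, if_neg hab]
        exact jacobiSym.mul_right' m (Nat.not_even_iff_odd.mp ha).pos.ne' (Nat.not_even_iff_odd.mp hb).pos.ne'
  have hεM : ε.IsMultiplicative := ⟨hε1, fun {a b} _ ↦ hεmul a b⟩
  have hεpow : ∀ (p k : ℕ), ε (p ^ k) = ε p ^ k := by
    intro p k
    induction k with
    | zero => rw [pow_zero, pow_zero, hε1]
    | succ k ih => rw [pow_succ, hεmul, ih, pow_succ]
  -- the fundamental discriminant `4m`
  have hfund : ((4 * m : ℤ) % 4 = 1 ∧ Squarefree (4 * m : ℤ) ∧ (4 * m : ℤ) ≠ 1) ∨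
      (4 ∣ (4 * m : ℤ) ∧ ((4 * m : ℤ) / 4 % 4 = 2 ∨ (4 * m : ℤ) / 4 % 4 = 3) ∧ Squarefree ((4 * m : ℤ) / 4)) := by
    refine Or.inr ⟨dvd_mul_right 4 m, ?_, ?_⟩ <;> rw [Int.mul_ediv_cancel_left m (by norm_num : (4 : ℤ) ≠ 0)]
    exacts [hm4, hsq]
  -- agreement on prime powers
  have hpp : ∀ (p k : ℕ), p.Prime → W.LFunction (p ^ k) = (ε.pmul W'.LFunction) (p ^ k) := by
    intro p k hp
    rw [ArithmeticFunction.pmul_apply, hεpow, LFunction_eq_LFunction_quadraticTwist_four_mul W W' hm4 hWtw,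
      W'.LFunction_quadraticTwist_prime_pow_of_fundamental hfund hss hp k]
    congr 2
    by_cases hp2 : p = 2
    · subst hp2
      have h2d : (2 : ℤ) ∣ 4 * m := ⟨2 * m, by ring⟩
      rw [if_pos rfl, if_pos h2d, hε, if_pos (by decide)]
    · have hodd : Odd p := hp.odd_of_ne_two hp2
      rw [if_neg hp2, hε, if_neg (Nat.not_even_iff_odd.mpr hodd),
        show (4 * m : ℤ) = 2 ^ 2 * m by norm_num, jacobiSym.mul_left, jacobiSym.sq_one'
          (by rw [Int.gcd_eq_natAbs]; exact Nat.Coprime.gcd_eq_one (Nat.coprime_two_left.mpr hodd)), one_mul]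
  have heq : W.LFunction = ε.pmul W'.LFunction :=
    (ArithmeticFunction.IsMultiplicative.eq_iff_eq_on_prime_powers _ W.isMultiplicative_LFunction _
      (hεM.pmul W'.isMultiplicative_LFunction)).mpr hpp
  have h := congrArg (fun g : ArithmeticFunction ℤ ↦ g n) heq
  simpa only [ArithmeticFunction.pmul_apply, hε] using h

omit [W'.IsElliptic] in
/-- A prime dividing `4m`, `m ∈ {−1, −2}`, is `2`; so semistability «at the primes of `4m`» is semistability at `2`.
[folklore] -/
theorem isSemistableAt_of_dvd_four_mul (hm : m = -1 ∨ m = -2)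
    (hss2 : ∀ v : HeightOneSpectrum (𝓞 ℚ), (primesEquiv v : ℕ) = 2 → W'.IsSemistableAt v) :
    ∀ v : HeightOneSpectrum (𝓞 ℚ), ((primesEquiv v : ℕ) : ℤ) ∣ 4 * m → W'.IsSemistableAt v := by
  intro v hv
  refine hss2 v ((Nat.prime_dvd_prime_iff_eq (primesEquiv v).2 Nat.prime_two).mp ?_)
  have h8 : ((primesEquiv v : ℕ) : ℤ) ∣ ((2 ^ 3 : ℕ) : ℤ) := by
    rcases hm with rfl | rfl
    · exact hv.trans ⟨-2, by norm_num⟩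
    · exact hv.trans ⟨-1, by norm_num⟩
  exact (primesEquiv v).2.dvd_of_dvd_pow (Int.natCast_dvd_natCast.mp h8)

end Coefficients

/-- A curve split multiplicative at the prime `2` is semistable at the place over `2`. [cite: SilvermanAEC2009, VII.5 Prop. 5.1] -/
theorem isSemistableAt_of_hasSplitMultiplicativeReductionAtPrime_two (W' : WeierstrassCurve ℚ) [W'.IsElliptic]
    (hsp : W'.HasSplitMultiplicativeReductionAtPrime 2) :
    ∀ v : HeightOneSpectrum (𝓞 ℚ), (primesEquiv v : ℕ) = 2 → W'.IsSemistableAt v := by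
  intro v hv
  have h2 : v = (primesEquiv (R := 𝓞 ℚ)).symm ⟨2, Nat.prime_two⟩ := by
    rw [Equiv.eq_symm_apply]; exact Subtype.ext hv
  subst h2
  have hsp' : (haveI := Fact.mk (primesEquiv ((primesEquiv (R := 𝓞 ℚ)).symm ⟨2, Nat.prime_two⟩)).2;
      W'.HasSplitMultiplicativeReductionAtPrime (primesEquiv ((primesEquiv (R := 𝓞 ℚ)).symm ⟨2, Nat.prime_two⟩))) := by
    simpa only [Equiv.apply_symm_apply] using hsp
  exact ((W'.hasSplitMultiplicativeReductionAtPrime_iff_hasSplitMultiplicativeReductionAt _).mp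
    hsp').hasMultiplicativeReductionAt.isSemistableAt

/-! ## §2 The (−1)-block: Birch's formula for `χ₋₄`, `L⁻₂(f_{W′}, 1, ω, T) ≠ 0`, and its integral lift -/

section NegOne

variable (W W' : WeierstrassCurve ℚ) [W.IsElliptic] [W'.IsElliptic]
  (hWtw : ∃ C : VariableChange ℚ, C • W'.quadraticTwist (-1) = W)
  {N : ℕ} [NeZero N] {f : CuspForm (Gamma0 N) 2} (hf : IsNewformOf W' f)

include hWtw hf in
/-- **`2·L(W, 1) = ([1/4]⁻_f − [3/4]⁻_f)·Ω⁻_f`** for `W ≅ W′^{(−1)}` with `W′` SEMISTABLE at `2` and `f` the newform of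
`W′`: the Dirichlet coefficients of `W` are `χ₋₄(n)·aₙ(f)` (§1, `m = −1`), so the entire `L(W, s)` (`hmod`) continues
`L(f, χ₋₄, s) = L(f, χ₋₄⁻¹, s)`; Birch's formula for the odd primitive character `χ₋₄` (tree THEOREM
`ratMinusTwistedSymbolSum_mul_minusPeriod_mul_I`, MTT §I.8 (8.6)) gives `(∑ χ(a)[a/4]⁻)·Ω⁻·i = τ(χ)·L(f, χ̄, 1)` with
`∑ χ(a)[a/4]⁻ = [1/4]⁻ − [3/4]⁻` and `τ(χ₋₄) = 2i`. The multiplicative-at-`2` twin of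
`AddDescentK.entireLFunction_one_mul_two_eq_of_twist_neg_four` (addL2 GEN 7, `W′` good at `2`).
[cite: MazurTateTeitelbaum1986Invent, §I.8 (8.6)] [cite: Cox2013, §1.C Lemma 1.14] [cite: SilvermanAEC2009, X.2 and Exercise 10.16] -/
theorem entireLFunction_one_mul_two_eq_of_twist_neg_one_of_isSemistableAt (hmod : hasEntireLFunction_rat)
    (hss : ∀ v : HeightOneSpectrum (𝓞 ℚ), (primesEquiv v : ℕ) = 2 → W'.IsSemistableAt v) :
    W.entireLFunction 1 * 2 =
      ((ratMinusSymbol f (1 / 4) - ratMinusSymbol f (3 / 4) : ℚ) : ℂ) * (minusPeriod f : ℂ) := by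
  -- adapted from `AddDescentK.entireLFunction_one_mul_two_eq_of_twist_neg_four` (…AdditiveDescentKClosed)
  obtain ⟨χ, hprim, hquad, hodd, hχ⟩ := AddDescentK.exists_dirichletCharacter_neg_four
  have hm4 : (-1 : ℤ) % 4 = 2 ∨ (-1 : ℤ) % 4 = 3 := Or.inr (by decide)
  have hWtw' : ∃ C : VariableChange ℚ, C • W'.quadraticTwist ((-1 : ℤ) : ℚ) = W := by push_cast; exact hWtw
  -- (1) the Dirichlet coefficients of `W` are `χ(n) aₙ(f)`
  have hco : ∀ n : ℕ, ((W.LFunction n : ℤ) : ℂ) = χ n * cuspCoeff f n := by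
    intro n
    rw [LFunction_eq_jacobiSym_mul_of_twist W W' hm4 (by norm_num) hWtw'
      (isSemistableAt_of_dvd_four_mul W' (Or.inl rfl) hss) n, hχ n, hf.2 n]
    split_ifs <;> push_cast <;> ring
  -- (2) `L(W, s) = L(f, χ⁻¹, s)` as `L`-series, and its entire continuation
  have hLS : ∀ s : ℂ, W.LSeries s = twistedLSeries f χ⁻¹ s := by
    intro s
    rw [hquad.inv]
    unfold WeierstrassCurve.LSeries twistedLSeries
    congr 1
    funext n
    exact hco n
  have hE : W.HasEntireLFunction := hmod W
  have hdiff : Differentiable ℂ W.entireLFunction := W.differentiable_entireLFunction hE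
  have hL' : ∀ s : ℂ, 2 < s.re → W.entireLFunction s = twistedLSeries f χ⁻¹ s := fun s hs ↦ by
    rw [W.entireLFunction_eq_LSeries hE (by linarith), hLS]
  -- (3) Birch's formula for the odd primitive `χ`
  have hB := ratMinusTwistedSymbolSum_mul_minusPeriod_mul_I f hf.1 hf.coeffField_eq_bot hprim hodd hdiff hL'
  have hv0 : (0 : ZMod 4).val = 0 := rfl
  have hv1 : (1 : ZMod 4).val = 1 := rfl
  have hv2 : (2 : ZMod 4).val = 2 := rfl
  have hv3 : (3 : ZMod 4).val = 3 := rfl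
  have hχ0 : χ 0 = 0 := by rw [← Nat.cast_zero, hχ 0]; simp
  have hχ1 : χ 1 = 1 := by rw [← Nat.cast_one, hχ 1]; simp [jacobiSym.one_right]
  have hχ2 : χ 2 = 0 := by
    change χ ((2 : ℕ) : ZMod 4) = 0
    rw [hχ 2]; simp
  have hχ3 : χ 3 = -1 := by
    change χ ((3 : ℕ) : ZMod 4) = -1
    rw [hχ 3, if_neg (by decide), jacobiSym.at_neg_one (by decide),
      ZMod.χ₄_nat_three_mod_four (by norm_num)]
    push_cast; ring
  have hsum : ratMinusTwistedSymbolSum f χ =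
      ((ratMinusSymbol f (1 / 4) - ratMinusSymbol f (3 / 4) : ℚ) : ℂ) := by
    rw [ratMinusTwistedSymbolSum, AddDescentK.sum_univ_zmod_four, hv0, hv1, hv2, hv3, hχ0, hχ1, hχ2, hχ3]
    push_cast
    ring_nf
  -- the Gauss sum `τ(χ) = 2i`
  have hgauss : gaussSum χ (ZMod.stdAddChar (N := 4)) = 2 * Complex.I := by
    rw [gaussSum, AddDescentK.sum_univ_zmod_four, AddDescentK.stdAddChar_zmod_four_eq_I_pow,
      AddDescentK.stdAddChar_zmod_four_eq_I_pow, AddDescentK.stdAddChar_zmod_four_eq_I_pow,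
      AddDescentK.stdAddChar_zmod_four_eq_I_pow, hv0, hv1, hv2, hv3, hχ0, hχ1, hχ2, hχ3]
    have hI3 : Complex.I ^ 3 = -Complex.I := by rw [pow_succ, Complex.I_sq]; ring
    rw [hI3]
    ring
  rw [hsum, hgauss] at hB
  -- (4) cancel `i`
  exact mul_right_cancel₀ Complex.I_ne_zero
    (show W.entireLFunction 1 * 2 * Complex.I =
      ((ratMinusSymbol f (1 / 4) - ratMinusSymbol f (3 / 4) : ℚ) : ℂ) * (minusPeriod f : ℂ) * Complex.I by
      rw [hB]; ring)

variable (hsp : W'.HasSplitMultiplicativeReductionAtPrime 2)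

include hWtw hsp hf in
/-- **`L⁻₂(f_{W′}, 1, ω, T) ≠ 0` whenever `L(W, 1) ≠ 0`**, for `W ≅ W′^{(−1)}` with `W′` SPLIT multiplicative at `2` and
`f` the newform of `W′`: the constant term of the odd branch of the one-term measure (`a₂ = 1`) is
`[1/4]⁻_f − [3/4]⁻_f` (`constantCoeff_padicLFunctionMinusBranchMult_one_two_of_split`, the `T = 0` interpolation at
`2 ∣ N`, MTT §I.13–I.14 with `ε(2) = 0`), and `([1/4]⁻ − [3/4]⁻)·Ω⁻_f = 2·L(W,1)`. In the crux's setting (`r_an(W) = 0`)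
the odd-branch multiple of Kato's divisibility is therefore non-zero — no Rohrlich-type input is needed.
[cite: MazurTateTeitelbaum1986Invent, §I.10 (10.1), §I.13–I.14, §I.8 (8.6)] -/
theorem padicLFunctionMinusBranchMult_ne_zero_of_entireLFunction_ne_zero (hmod : hasEntireLFunction_rat)
    (hL : W.entireLFunction 1 ≠ 0) : padicLFunctionMinusBranchMult f (1 : ℚ_[2]) 1 ≠ 0 := by
  haveI : Fact (Nat.Prime 2) := ⟨Nat.prime_two⟩
  intro h0
  have hc := constantCoeff_padicLFunctionMinusBranchMult_one_two_of_split hf hsp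
  rw [h0, map_zero] at hc
  have hq : (ratMinusSymbol f (1 / 4) - ratMinusSymbol f (3 / 4) : ℚ) = 0 := by
    have h' : (((ratMinusSymbol f (1 / 4) - ratMinusSymbol f (3 / 4) : ℚ)) : ℚ_[2]) = 0 := by
      push_cast; exact hc.symm
    exact_mod_cast h'
  have h2 := entireLFunction_one_mul_two_eq_of_twist_neg_one_of_isSemistableAt W W' hWtw hf hmod
    (isSemistableAt_of_hasSplitMultiplicativeReductionAtPrime_two W' hsp)
  rw [hq, Rat.cast_zero, zero_mul] at h2
  exact hL (by simpa using h2)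

omit [W'.IsElliptic] in
include hsp hf in
/-- **`L⁻₂(f_{W′}, 1, ω, T) ∈ Λ = ℤ₂⟦T⟧`**: the odd branch of the one-term measure of a curve split multiplicative at `2` is
INTEGRAL — tree `exists_iwasawaToPowerSeries_eq_padicLFunctionMinusBranchMult_two` (MTT §I.12–13: `2 ∥ N` by
`IsNewformOf.dvd_level_of_split` / `not_sq_dvd_level_of_lFunction_ne_zero`, `a₂ = 1`; no hypothesis on `E[2]`, the image
or the Manin constant). [cite: MazurTateTeitelbaum1986Invent, §I.12–I.13] -/
theorem exists_iwasawa_lift_oddBranch :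
    ∃ G : IwasawaAlgebra 2, iwasawaToPowerSeries 2 G = padicLFunctionMinusBranchMult f ((1 : ℤ) : ℚ_[2]) 1 := by
  haveI : Fact (Nat.Prime 2) := ⟨Nat.prime_two⟩
  have ha₂ : cuspCoeff f 2 = ((1 : ℤ) : ℂ) := by
    rw [Int.cast_one]; exact (hf.cuspCoeff_eq_one_and_sq_of_split hsp).1
  have hL2 : W'.LFunction 2 ≠ 0 := by
    have h := hf.2 2
    rw [ha₂, Int.cast_one] at h
    have h1' : W'.LFunction 2 = 1 := by exact_mod_cast h.symm
    rw [h1']; exact one_ne_zero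
  have h4N : ¬ 4 ∣ N := by
    rw [show (4 : ℕ) = 2 ^ 2 by norm_num]
    exact hf.not_sq_dvd_level_of_lFunction_ne_zero Nat.prime_two hL2
  exact exists_iwasawaToPowerSeries_eq_padicLFunctionMinusBranchMult_two hf.1 hf.coeffField_eq_bot
    (hf.dvd_level_of_split hsp) h4N ha₂ (Or.inl rfl) odd_one

include hWtw hsp hf in
/-- **`∃ L̃ ∈ Λ` with `ι L̃ = 2⁰ · L⁻₂(f_{W′}, 1, ω, T)` and `L̃ ≠ 0`** (`L(W,1) ≠ 0`): integrality (`exists_iwasawa_lift_oddBranch`)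
and non-vanishing (`padicLFunctionMinusBranchMult_ne_zero_of_entireLFunction_ne_zero`). This is the binder
`(Lt, m, hLt, hLt0)` of the (−1)-block print-level doors, SUPPLIED with `m = 0`. [cite: MazurTateTeitelbaum1986Invent, §I.12–I.14] -/
theorem exists_iwasawa_lift_oddBranch_ne_zero (hmod : hasEntireLFunction_rat) (hL : W.entireLFunction 1 ≠ 0) :
    ∃ Lt : IwasawaAlgebra 2,
      iwasawaToPowerSeries 2 Lt =
          PowerSeries.C ((2 : ℚ_[2]) ^ (0 : ℕ)) * padicLFunctionMinusBranchMult f (1 : ℚ_[2]) 1 ∧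
        Lt ≠ 0 := by
  obtain ⟨G, hG⟩ := exists_iwasawa_lift_oddBranch W' hf hsp
  rw [Int.cast_one] at hG
  refine ⟨G, by rw [hG, pow_zero, map_one, one_mul], fun hG0 ↦ ?_⟩
  rw [hG0, map_zero] at hG
  exact padicLFunctionMinusBranchMult_ne_zero_of_entireLFunction_ne_zero W W' hWtw hf hsp hmod hL hG.symm

end NegOne

end Summit.BirchSwinnertonDyer.BirchSwinnertonDyer.Theorems.AddKatoTwo

end
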